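import Summits.QuantumFields.BalabanUV.Beta.RemainderExplicitHistoryJunction
import Summits.QuantumFields.BalabanUV.Beta.EriceRemainderEnclosureHolomorphyNecessity

/-!
# RemainderExplicitScaleDrift — road P3 at co-owner #2's (E16): THE EXPLICIT RESIDUAL (R) IS UNINHABITABLE OVER THE ENTIRE
# MARKOV FAMILY once `ε₁·K_rem,L < r₀`; what (R) at small ε₁ refuses there is SCALE DRIFT — the per-scale junction «∀ k ∃ γ₁»
# holds for that family while the junction «∃ γ₁ ∀ k» fails: the quantifier swap is the load-bearing letter

Cell `pub-balaban`, β-function sub-cell, BINDER row D4 «RemainderConst leaves for Bałaban's split» (`HOME/BINDER-OWNERS.md`, owner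
lineage `b2b-balaban-beta-an4`); this file by the row's co-owner #3 lineage `b2b-balaban-beta-d4-p3` (ROAD P3 = the reduction road,
series `Summits/QuantumFields/BalabanUV/Beta/RemainderExplicit*.lean`; skeleton `HOME/beta/skeletons/D4-b2b-balaban-beta-d4-p3.md`),
generation 32, β-FLOW TEAM duty (1) under the coordinator rulings «YM REDIRECT TOWARDS THE SUMMIT» (FREEZE (0) honoured: a def-free
module in road P3's own series; no leaf, no interface, no folklore-algebra module) and «YM ACCELERATION».  OCCASION: co-owner #2's
(E16) `EriceRemainderEnclosureHolomorphyNecessity` (beta-d4-p2 generation 22; XREAD C-d4p3-91, junction pin J-o): the ENTIRE MARKOV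
family β_{k+1}(g₀,…,g_k) = r₀(1 − e^{−(k+1)g_k}), r₀ > 0 — every last-variable section analytic with all derivatives bounded PER
SCALE ([I] p. 264 tl.25–27 in its per-j reading), (D4-J5)'s holomorphy hypothesis satisfied with EITHER uniformity dropped — has
`RemainderConst S γ r ↔ r₀ ≤ r` on every box and NO junction.  Road P3's END (`RemainderExplicitEnd.exists_remainderConst_of_residualChain`)
delivers ONE remainder constant `r⋆ = c.ε₁·remCoeffL 4 Mc c α₂ B₃` for ALL scales k at once.  This module records where the two meet.

HONEST FRAMING (BETA-SPEC §0.2, verbatim and binding). *"Discharging BetaPertH makes Bałaban's UV stability UNCONDITIONAL — a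
real constructive-QFT result; it is NOT the continuum limit and NOT the Clay problem."*  THIS MODULE DISCHARGES NOTHING: elementary
real analysis on the tree's typed shapes `FlowStep.HBeta`, `B12Beta.OneLoopSplit` ([I] (2.12)–(2.14) p. 268), `RemainderChain.RemainderConst`,
road P3's `ResidualChain` ∕ `carrierFamily`, plus by-name use of road P3's END and of (E16); the family is carried as a HYPOTHESIS
`hβ` (no definition); nothing of Bałaban's (1.22) is asserted, constructed or instantiated; row D4 class UNCHANGED (critical-path
width 0: THE INSTANCE over NODE O.2 absent; instance 0∕1; D4 DISCHARGE NO DATE).  NOT BetaPertH, NOT continuum, NOT Clay.  HONEST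
DEPENDENCY: continuum YM on T⁴ ⇐ BetaPertH ∧ nine spine estimates (0/9 proved); BetaPertH ⇐ (D1) ∧ (D4) ∧ CAP+tail; G-an2-4 gates
asym, D1 and NE2/3/4.

WHAT IS PROVED ([folklore]; 0 sorry; 0 `def`).
* §1 SPLIT-FREE CURRENCY: `split_β0_eq_zero` (EVERY one-loop split of the family has β⁰ ≡ 0 — `vanish` at the zero history; this
  DISCHARGES the split hypothesis `hS0 : ∀ k, S.β0 k = 0` that (E16) carries as a binder), hence
  `le_of_remainderConst` ((E16)'s `expfam_le_of_remainderConst` for every split: a remainder constant on a box γ > 0 is ≥ r₀) and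
  `remainderConst_iff` (`RemainderConst S γ r ↔ r₀ ≤ r`, every split, every box γ > 0).
* §2 **`isEmpty_residualChain_expfam`** — with road P3's END constants `(δ₀⋆, B₃)`: for EVERY split `S`, at any constants meeting the
  numeric conditions (`CondsL 4 c ℓ`, `c.R22gen ℓ`, `0 ≤ c.C3act·c.ε₁`, `0 < α₂`, `0 < c.δ₀ ≤ δ₀⋆`) with `c.ε₁·remCoeffL 4 Mc c α₂ B₃ < r₀`
  and any box `γ > 0`, the explicit residual (R) `ResidualChain 4 Mc μ ν S γ c ℓ α₂ (carrierFamily …)` has NO inhabitant; and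
  `no_vanishing_residualChains_expfam` — the hypothesis of `RemainderExplicitHistoryJunction.junction_of_residualChains` (for every
  tolerance b > 0 a residual chain with `ε₁·K_rem,L < b`) is UNINHABITED over the family (it fails at b = r₀).
* §3 SCALE DRIFT, BY NAME: `perScale_af1` (`|β¹_{k+1}(p)| ≤ r₀(k+1)·g_k` — (AF-1) holds AT EACH SCALE with the honest constant r₀(k+1),
  `1 − e^{−x} ≤ x`); `perScale_junction` (for each scale k and each b > 0 a box `]0, b∕(2r₀(k+1))]` on which `|β¹_{k+1}| < b`);
  **`quantifierSwap_loadBearing`** (the PER-SCALE junction «∀ k ∀ b ∃ γ₁» HOLDS while the JUNCTION «∀ b ∃ γ₁ ∀ γ ≤ γ₁ ∃ r < b,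
  RemainderConst S γ r» — r serving ALL k — FAILS, by (E16)'s `expfam_junction_elim`): the swap ∃γ₁∀k ↦ ∀k∃γ₁ is exactly what the
  family exploits; road P3's `r⋆` is quantified BEFORE k (one constant for all scales), which is why §2 excludes the family.
* END `scaleDrift_census` — the three faces of road P3's non-inhabitation series side by side, BY NAME: (E11)'s history family
  (`isEmpty_residualChain_E11`: memory, oscillation > 2r⋆), the (D4-J3) perturbation of a Markov datum (`isEmpty_residualChain_historyBlind`:
  a jump, 2r⋆ < |M|), and the entire Markov family (`isEmpty_residualChain_expfam`: scale drift, r⋆ < r₀).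
READING (for CITATION-FIT §2 (α) ∕ SPINE S-D4, beside (E16) and (D4-J5)): the explicit residual (R) at small ε₁ is SCALE-UNIFORM by
construction — its exit is one `RemainderConst S γ r⋆` over all k — so it refuses, besides memory ((E11)) and jumps ((D4-J3)), the
third junction-failure mode, an analytic Markov diagonal drifting to r₀ at late scales; per-scale regularity of any strength (here:
entire, per-scale (AF-1) with constant r₀(k+1)) is compatible with that drift.  The uniformity in k that (D4-J5)'s pair (ρ, M)
carries on the R-264 side is carried, on road P3's side, by ε₁ — GIVEN THE INSTANCE (0∕1).  Class UNCHANGED.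

ABSOLUTE RULE (cell charter, verbatim): "No internally-minted statement may enter as a cited fact. Every hypothesis is either
kernel-proved in this package or a verbatim quotation of a PUBLISHED theorem with page reference."  Nothing is cited as a fact here.
-/

noncomputable section

open Filter
open Literature.MathematicalPhysics.QuantumFieldTheory.Balaban1983to89
open Literature.MathematicalPhysics.QuantumFieldTheory.Balaban1983to89.Beta
open Literature.MathematicalPhysics.QuantumFieldTheory.Balaban1983to89.FlowStep (HBeta)
open Literature.MathematicalPhysics.QuantumFieldTheory.Balaban1983to89.Beta.RemainderChain (RemainderConst)
open Literature.MathematicalPhysics.QuantumFieldTheory.Balaban1983to89.Beta.RemainderChainLattice (CondsL remCoeffL)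
open Summit.QuantumFields.BalabanUV.Beta.RemainderExplicitRoad (ResidualChain)
open Summit.QuantumFields.BalabanUV.Beta.RemainderExplicitEnd (carrierFamily exists_remainderConst_of_residualChain)
open Summit.QuantumFields.BalabanUV.Beta.RemainderExplicitHistoryJunction (isEmpty_residualChain_E11
  isEmpty_residualChain_historyBlind)
open Summit.QuantumFields.BalabanUV.Beta.EriceRemainderEnclosureHolomorphyNecessity (expfam_β1_eq expfam_remainderConst
  expfam_le_of_remainderConst expfam_junction_elim)

namespace Summit.QuantumFields.BalabanUV.Beta.RemainderExplicitScaleDrift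

variable {β : HBeta} {r₀ : ℝ}

section ExpFam

variable (hβ : ∀ (k : ℕ) (p : Fin (k + 1) → ℝ), β k p = r₀ * (1 - Real.exp (-(((k : ℝ) + 1) * p (Fin.last k)))))
include hβ

/-! ## §1 Split-free currency: every split of the family has one-loop part `0` -/

/-- **Every one-loop split of the family has `β⁰ ≡ 0`**: evaluate the split at the zero history, where `β¹` vanishes ([I] (2.14))
and `β = r₀(1 − e⁰) = 0`. [folklore] -/
theorem split_β0_eq_zero (S : B12Beta.OneLoopSplit β) (k : ℕ) : S.β0 k = 0 := by
  have h := S.split k (fun _ => 0)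
  rw [S.vanish k _ rfl, hβ k] at h
  simpa using h.symm

/-- **Every remainder constant of every split on a box `γ > 0` is at least `r₀`** ((E16)'s `expfam_le_of_remainderConst`, the split
hypothesis discharged by `split_β0_eq_zero`). [folklore] -/
theorem le_of_remainderConst (hr₀ : 0 < r₀) (S : B12Beta.OneLoopSplit β) {γ r : ℝ} (hγ : 0 < γ)
    (hR : RemainderConst S γ r) : r₀ ≤ r :=
  expfam_le_of_remainderConst hβ S (split_β0_eq_zero hβ S) hr₀ hγ hR

/-- `RemainderConst S γ r ↔ r₀ ≤ r` for EVERY split and every box `γ > 0`. [folklore] -/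
theorem remainderConst_iff (hr₀ : 0 < r₀) (S : B12Beta.OneLoopSplit β) {γ : ℝ} (hγ : 0 < γ) (r : ℝ) :
    RemainderConst S γ r ↔ r₀ ≤ r :=
  ⟨le_of_remainderConst hβ hr₀ S hγ,
    fun h k p hp => (expfam_remainderConst hβ S (split_β0_eq_zero hβ S) hr₀ γ k p hp).trans h⟩

/-! ## §2 The explicit residual (R) is uninhabitable over the family once `ε₁·K_rem,L < r₀` -/

variable (Lc : ℕ) [NeZero Lc] (Mc : ℕ) [NeZero Mc] (Nn : ℕ → ℕ) [∀ n, NeZero (Nn n)]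

/-- [folklore] **THE EXPLICIT RESIDUAL (R) IS UNINHABITABLE OVER THE ENTIRE MARKOV FAMILY once `ε₁·K_rem,L < r₀`.**  With road P3's
END constants `(δ₀⋆, B₃)` (`RemainderExplicitEnd.exists_remainderConst_of_residualChain`: along any residual chain ONE remainder
constant `r⋆ = c.ε₁·remCoeffL 4 Mc c α₂ B₃`, the same for every scale k): for EVERY split `S` of the family, at any constants meeting
the numeric conditions with `c.δ₀ ≤ δ₀⋆` and `r⋆ < r₀`, and any box `γ > 0`, there is NO residual chain (R) for `(S, γ, c, ℓ, α₂)`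
relative to the explicit carrier family (§1 `le_of_remainderConst`).  The family is entire in g_k with every derivative bounded per
scale ((E16) §2); what (R) refuses is not regularity but the drift of the diagonal to `r₀` at late scales (§3). -/
theorem isEmpty_residualChain_expfam (hN : Tendsto Nn atTop atTop) (μ ν : Fin 4) (hr₀ : 0 < r₀) :
    ∃ δ₀ B₃ : ℝ, 0 < δ₀ ∧ 0 ≤ B₃ ∧
      ∀ (S : B12Beta.OneLoopSplit β) {γ : ℝ} {c : B13.Consts} {ℓ α₂ : ℝ},
        CondsL 4 c ℓ → c.R22gen ℓ → 0 ≤ c.C3act * c.ε₁ → 0 < α₂ → 0 < c.δ₀ → c.δ₀ ≤ δ₀ → 0 < γ →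
          c.ε₁ * remCoeffL 4 Mc c α₂ B₃ < r₀ →
          IsEmpty (ResidualChain 4 Mc μ ν S γ c ℓ α₂ (carrierFamily Lc Mc Nn hN μ ν)) := by
  obtain ⟨δ₀, B₃, hδ, hB, hEND⟩ := exists_remainderConst_of_residualChain Lc Mc Nn hN μ ν
  refine ⟨δ₀, B₃, hδ, hB, ?_⟩
  intro S γ c ℓ α₂ hC h22 hA hα₂ hδpos hδle hγ hlt
  exact ⟨fun R => (not_le.mpr hlt) (le_of_remainderConst hβ hr₀ S hγ (hEND R hC h22 hA hα₂ hδpos hδle))⟩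

/-- [folklore] **NO VANISHING FAMILY OF RESIDUAL CHAINS OVER THE FAMILY**: with road P3's END constants, the hypothesis of
`RemainderExplicitHistoryJunction.junction_of_residualChains` — «for every tolerance `b > 0`: constants meeting the numeric conditions
with `c.ε₁·remCoeffL 4 Mc c α₂ B₃ < b`, a box `γ > 0`, and an inhabitant of (R)» — FAILS for every split of the family (already at
the tolerance `b = r₀`, by `isEmpty_residualChain_expfam`); consistently with (E16)'s `expfam_junction_elim` (the conclusion of
`junction_of_residualChains` would be the junction, which the family lacks). -/
theorem no_vanishing_residualChains_expfam (hN : Tendsto Nn atTop atTop) (μ ν : Fin 4) (hr₀ : 0 < r₀) :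
    ∃ δ₀ B₃ : ℝ, 0 < δ₀ ∧ 0 ≤ B₃ ∧
      ∀ (S : B12Beta.OneLoopSplit β),
        ¬ (∀ b : ℝ, 0 < b → ∃ (γ : ℝ) (c : B13.Consts) (ℓ α₂ : ℝ),
            0 < γ ∧ CondsL 4 c ℓ ∧ c.R22gen ℓ ∧ 0 ≤ c.C3act * c.ε₁ ∧ 0 < α₂ ∧ 0 < c.δ₀ ∧ c.δ₀ ≤ δ₀ ∧
            c.ε₁ * remCoeffL 4 Mc c α₂ B₃ < b ∧
            Nonempty (ResidualChain 4 Mc μ ν S γ c ℓ α₂ (carrierFamily Lc Mc Nn hN μ ν))) := by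
  obtain ⟨δ₀, B₃, hδ, hB, hE⟩ := isEmpty_residualChain_expfam hβ Lc Mc Nn hN μ ν hr₀
  refine ⟨δ₀, B₃, hδ, hB, fun S hfam => ?_⟩
  obtain ⟨γ, c, ℓ, α₂, hγ, hC, h22, hA, hα₂, hδpos, hδle, hlt, ⟨R⟩⟩ := hfam r₀ hr₀
  exact (hE S hC h22 hA hα₂ hδpos hδle hγ hlt).false R

/-! ## §3 Scale drift, by name: per-scale (AF-1) and the per-scale junction hold; the junction fails -/

/-- **(AF-1) HOLDS AT EACH SCALE with the honest constant `r₀(k+1)`**: `|β¹_{k+1}(p)| ≤ r₀(k+1)·g_k` for every history with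
`g_k ≥ 0` and every split (`1 − e^{−x} ≤ x`; `r₀ ≥ 0`).  The constant `r₀(k+1)` is (E16)'s derivative value at `g_k = 0`,
`EriceRemainderEnclosureHolomorphyNecessity.expfam_hasDerivAt_zero` (so the two files visibly agree; the OWNER's N-an4-62-1); the
constants are unbounded in k — (E16)'s `expfam_not_af1` says no k-uniform constant exists on any box. [folklore] -/
theorem perScale_af1 (hr₀ : 0 ≤ r₀) (S : B12Beta.OneLoopSplit β) (k : ℕ) (p : Fin (k + 1) → ℝ)
    (hp : 0 ≤ p (Fin.last k)) : |S.β1 k p| ≤ r₀ * (((k : ℝ) + 1) * p (Fin.last k)) := by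
  rw [expfam_β1_eq hβ S (split_β0_eq_zero hβ S) k p]
  have hx : 0 ≤ ((k : ℝ) + 1) * p (Fin.last k) := by positivity
  have h1 : 0 ≤ 1 - Real.exp (-(((k : ℝ) + 1) * p (Fin.last k))) := by
    have := Real.exp_le_one_iff.mpr (neg_nonpos.mpr hx)
    linarith
  have h2 : 1 - Real.exp (-(((k : ℝ) + 1) * p (Fin.last k))) ≤ ((k : ℝ) + 1) * p (Fin.last k) := by
    have := Real.add_one_le_exp (-(((k : ℝ) + 1) * p (Fin.last k)))
    linarith
  rw [abs_of_nonneg (mul_nonneg hr₀ h1)]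
  exact mul_le_mul_of_nonneg_left h2 hr₀

/-- **THE PER-SCALE JUNCTION HOLDS**: for each scale `k` and each tolerance `b > 0` there is a box `]0, γ₁]^{k+1}`,
`γ₁ = b ∕ (2·r₀·(k+1))`, on which `|β¹_{k+1}| < b` — for every split. [folklore] -/
theorem perScale_junction (hr₀ : 0 < r₀) (S : B12Beta.OneLoopSplit β) (k : ℕ) {b : ℝ} (hb : 0 < b) :
    ∃ γ₁ : ℝ, 0 < γ₁ ∧ ∀ (p : Fin (k + 1) → ℝ), p ∈ B12Beta.HistBox γ₁ k → |S.β1 k p| < b := by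
  have hk : 0 < r₀ * ((k : ℝ) + 1) := by positivity
  refine ⟨b / (2 * (r₀ * ((k : ℝ) + 1))), by positivity, fun p hp => ?_⟩
  have hpk := hp (Fin.last k)
  calc |S.β1 k p| ≤ r₀ * (((k : ℝ) + 1) * p (Fin.last k)) := perScale_af1 hβ hr₀.le S k p hpk.1.le
    _ = (r₀ * ((k : ℝ) + 1)) * p (Fin.last k) := by ring
    _ ≤ (r₀ * ((k : ℝ) + 1)) * (b / (2 * (r₀ * ((k : ℝ) + 1)))) := mul_le_mul_of_nonneg_left hpk.2 hk.le
    _ = b / 2 := by field_simp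
    _ < b := half_lt_self hb

/-- **THE QUANTIFIER SWAP IS LOAD-BEARING**: for every split of the family the PER-SCALE junction «∀ k ∀ b > 0 ∃ γ₁ > 0 …» HOLDS
(`perScale_junction`) while the JUNCTION «∀ b > 0 ∃ γ₁ > 0 ∀ γ ∈ ]0,γ₁] ∃ r ∈ [0,b[, RemainderConst S γ r» — one `r` serving ALL
scales — FAILS ((E16)'s `expfam_junction_elim`).  Road P3's END constant `r⋆` is quantified before `k`; hence §2. [folklore] -/
theorem quantifierSwap_loadBearing (hr₀ : 0 < r₀) (S : B12Beta.OneLoopSplit β) :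
    (∀ (k : ℕ) (b : ℝ), 0 < b → ∃ γ₁ : ℝ, 0 < γ₁ ∧ ∀ (p : Fin (k + 1) → ℝ), p ∈ B12Beta.HistBox γ₁ k → |S.β1 k p| < b) ∧
    ¬ (∀ b : ℝ, 0 < b → ∃ γ₁ : ℝ, 0 < γ₁ ∧ ∀ γ : ℝ, 0 < γ → γ ≤ γ₁ →
        ∃ r : ℝ, 0 ≤ r ∧ r < b ∧ RemainderConst S γ r) :=
  ⟨fun k _ hb => perScale_junction hβ hr₀ S k hb,
    fun hJ => (lt_irrefl r₀) (expfam_junction_elim hβ S (split_β0_eq_zero hβ S) hr₀ hJ)⟩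

end ExpFam

/-! ## END -/

/-- **ROAD P3's NON-INHABITATION CENSUS — THREE FACES, BY NAME.**  With road P3's END constants (one pair `(δ₀⋆, B₃)` per clause),
at constants meeting the numeric conditions and any box `γ > 0`, the explicit residual (R) relative to the explicit carrier family has
NO inhabitant: (i) over (E11)'s HISTORY family `β = b + M·h(p_k∕p_0)` once `r⋆ < M` (`isEmpty_residualChain_E11` — memory: its
oscillation exceeds `2r⋆`); (ii) over the (D4-J3) perturbation `−βE k (p_k²) + M·h(p_k∕p_0)` of ANY Markov datum once `2r⋆ < |M|`
(`isEmpty_residualChain_historyBlind` — a jump; `r⋆ < M` under one-scale continuity); (iii) over the ENTIRE MARKOV family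
`r₀(1 − e^{−(k+1)g_k})` once `r⋆ < r₀` (`isEmpty_residualChain_expfam` — scale drift: per-scale junction yes, junction no,
`quantifierSwap_loadBearing`).  What (R) at small ε₁ refuses is, respectively, memory, discontinuity, and non-uniformity in the
scale.  Nothing of Bałaban's asserted; class UNCHANGED. [folklore] -/
theorem scaleDrift_census (Lc : ℕ) [NeZero Lc] (Mc : ℕ) [NeZero Mc] (Nn : ℕ → ℕ) [∀ n, NeZero (Nn n)]
    (hN : Tendsto Nn atTop atTop) (μ ν : Fin 4) :
    (∀ {β : HBeta} {b M : ℝ},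
      (∀ (k : ℕ) (p : Fin (k + 1) → ℝ),
        β k p = b + M * max 0 (min 1 (4 * (p (Fin.last k) / p 0) * (1 - p (Fin.last k) / p 0)))) →
      ∃ δ₀ B₃ : ℝ, 0 < δ₀ ∧ 0 ≤ B₃ ∧
        ∀ (S : B12Beta.OneLoopSplit β) {γ : ℝ} {c : B13.Consts} {ℓ α₂ : ℝ},
          CondsL 4 c ℓ → c.R22gen ℓ → 0 ≤ c.C3act * c.ε₁ → 0 < α₂ → 0 < c.δ₀ → c.δ₀ ≤ δ₀ → 0 < γ →
            c.ε₁ * remCoeffL 4 Mc c α₂ B₃ < M →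
            IsEmpty (ResidualChain 4 Mc μ ν S γ c ℓ α₂ (carrierFamily Lc Mc Nn hN μ ν))) ∧
    (∀ {β : HBeta} {βE : ℕ → ℝ → ℝ} {M : ℝ},
      (∀ (k : ℕ) (p : Fin (k + 1) → ℝ), β k p =
        -(βE k (p (Fin.last k) ^ 2)) + M * max 0 (min 1 (4 * (p (Fin.last k) / p 0) * (1 - p (Fin.last k) / p 0)))) →
      ∃ δ₀ B₃ : ℝ, 0 < δ₀ ∧ 0 ≤ B₃ ∧
        ∀ (S : B12Beta.OneLoopSplit β) {γ : ℝ} {c : B13.Consts} {ℓ α₂ : ℝ},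
          CondsL 4 c ℓ → c.R22gen ℓ → 0 ≤ c.C3act * c.ε₁ → 0 < α₂ → 0 < c.δ₀ → c.δ₀ ≤ δ₀ → 0 < γ →
            2 * (c.ε₁ * remCoeffL 4 Mc c α₂ B₃) < |M| →
            IsEmpty (ResidualChain 4 Mc μ ν S γ c ℓ α₂ (carrierFamily Lc Mc Nn hN μ ν))) ∧
    (∀ {β : HBeta} {r₀ : ℝ},
      (∀ (k : ℕ) (p : Fin (k + 1) → ℝ), β k p = r₀ * (1 - Real.exp (-(((k : ℝ) + 1) * p (Fin.last k))))) → 0 < r₀ →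
      (∃ δ₀ B₃ : ℝ, 0 < δ₀ ∧ 0 ≤ B₃ ∧
        ∀ (S : B12Beta.OneLoopSplit β) {γ : ℝ} {c : B13.Consts} {ℓ α₂ : ℝ},
          CondsL 4 c ℓ → c.R22gen ℓ → 0 ≤ c.C3act * c.ε₁ → 0 < α₂ → 0 < c.δ₀ → c.δ₀ ≤ δ₀ → 0 < γ →
            c.ε₁ * remCoeffL 4 Mc c α₂ B₃ < r₀ →
            IsEmpty (ResidualChain 4 Mc μ ν S γ c ℓ α₂ (carrierFamily Lc Mc Nn hN μ ν))) ∧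
      ∀ S : B12Beta.OneLoopSplit β,
        (∀ (k : ℕ) (b : ℝ), 0 < b → ∃ γ₁ : ℝ, 0 < γ₁ ∧ ∀ (p : Fin (k + 1) → ℝ), p ∈ B12Beta.HistBox γ₁ k → |S.β1 k p| < b) ∧
        ¬ (∀ b : ℝ, 0 < b → ∃ γ₁ : ℝ, 0 < γ₁ ∧ ∀ γ : ℝ, 0 < γ → γ ≤ γ₁ →
            ∃ r : ℝ, 0 ≤ r ∧ r < b ∧ RemainderConst S γ r)) :=
  ⟨fun hβ => isEmpty_residualChain_E11 Lc Mc Nn hN μ ν hβ,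
    fun hβ => isEmpty_residualChain_historyBlind Lc Mc Nn hN μ ν hβ,
    fun hβ hr₀ => ⟨isEmpty_residualChain_expfam hβ Lc Mc Nn hN μ ν hr₀, fun S => quantifierSwap_loadBearing hβ hr₀ S⟩⟩

end Summit.QuantumFields.BalabanUV.Beta.RemainderExplicitScaleDrift

end
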